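import Mathlib
import HarnessLib
import Literature.MathematicalPhysics.QuantumLattice.ThinSectorCooperTolerance
import Literature.MathematicalPhysics.QuantumLattice.ThinSectorFoldTolerance
import Literature.MathematicalPhysics.QuantumLattice.AnisotropicSectors
import Summits.HubbardSuperconductivity.HubbardSuperconductivity.Theorems.KLProgrammeH10TwoPointLimitPerturbedCountLipschitz
import Summits.HubbardSuperconductivity.HubbardSuperconductivity.Theorems.KLProgrammeH10TwoPointLimitPerturbedCountSymmetry
import Summits.HubbardSuperconductivity.HubbardSuperconductivity.Theorems.KLProgrammeH10TwoPointLimitPerturbedFermiRadiusAccelBand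
import Summits.HubbardSuperconductivity.HubbardSuperconductivity.Theorems.KLProgrammeKLRegimeSplitFermiPointLevelC4
import Summits.HubbardSuperconductivity.HubbardSuperconductivity.Theorems.KLProgrammePerturbedCountConstantsDefs

/-!
# Route `KLProgramme` — K3 engine child `KLRegimeEngineV17F2` (stmt-HubbardSuperconductivity-20437), stub (b) import ι₂:
# the THIN tolerances of the anchored four-leg count ON THE PERTURBED CURVE (instance of the abstract tolerance layer)

Cell gate-hubbard-kl, plan g17 (R41)(i) «E1-P2-THIN-COUNT» (seat p4; plan HOME/prover-p4/E1-P2-THIN-COUNT-PLAN.md §Refinement 3, «file 4» on the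
(β)-port curve).  The abstract first-order tolerance lemmas of `ThinSectorCount` (`abs_level3_le_thin`, `abs_level3_le_thin_fold`,
`abs_level3_le_of_near_zero_fat`: a near-solution `(θ₁′, x′, y′)` of `E(γθ₁ + γx + γy) = μ` within `ω ≤ w` of the cell centres, with `E(γθ) ≡ μ`,
`γ(θ + π) = −γθ`, `‖E′‖ ≤ G`, `E′` `H`-Lipschitz, `‖γ′‖ ≤ V`, `γ′` `A`-Lipschitz) instantiated at `F = ℝ²` (sup norm), `E = ε₀ + δ` (`δ ∈ C²` even,
`‖Dδ‖ ≤ κ₁`, `‖D²δ‖ ≤ κ₂`; `G = 4 + κ₁`, `H = 4 + κ₂` by `‖Dⁱε₀‖ ≤ 4`), `γ = p_E` (`V = S_E`, `A = A_E`), so that `E(γθ₁ + γθ₂ + γθ₃) − μ = h^E_{p_E(θ₁)}(θ₂, θ₃)`: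

* `hasFDerivAt_bandPlus`, `norm_fderiv_bandPlus_le`, `norm_fderiv_bandPlus_sub_le` (the data of `E = ε₀ + δ`);
* `hasDerivAt_curveVec`, `norm_curveVec_deriv_le`, `norm_curveVec_deriv_sub_le`, `curveVec_add_pi`, `bandPlus_curveVec`, `hfunE_eq_bandPlus_curveVec`;
* **`abs_hfunE_le_thin_cooper`**, **`abs_hfunE_le_thin_fold`**, **`abs_hfunE_le_fat`** — the three tolerances at the cell centres from a near-solution.

Everything is PROVED; no definitions.  References: BGM 2006 Lemma 3.1 / App. A2–A3 [cite: BenfattoGiulianiMastropietro2006]; Mastropietro 2008 (14.67)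
p. 223 [cite: Mastropietro2008].
-/

noncomputable section

namespace Summit.HubbardSuperconductivity.HubbardSuperconductivity.Theorems.PerturbedFermiCurve

set_option linter.dupNamespace false -- summit = problem name (single-conjunct summit), D-0017

open Real Set
open Literature.MathematicalPhysics.QuantumLattice Literature.MathematicalPhysics.QuantumLattice.BandSectorCounting
open Literature.MathematicalPhysics.QuantumLattice.ThinSectorCount
open Summit.HubbardSuperconductivity.HubbardSuperconductivity.Theorems.KLRegimeSplit

/-! ## §1 The level function `E = ε₀ + δ` on `ℝ²` (sup norm) -/

section BandPlus

variable {δ : (Fin 2 → ℝ) → ℝ} (hδs : ContDiff ℝ 2 δ) {κ₁ κ₂ : ℝ}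
  (hκ : ∀ k : Fin 2 → ℝ, ‖fderiv ℝ δ k‖ ≤ κ₁) (hκ₂ : ∀ k : Fin 2 → ℝ, ‖fderiv ℝ (fderiv ℝ δ) k‖ ≤ κ₂)

include hδs in
/-- `E = ε₀ + δ` is differentiable with derivative `fderiv E`. [folklore] -/
theorem hasFDerivAt_bandPlus (x : Fin 2 → ℝ) :
    HasFDerivAt (fun k : Fin 2 → ℝ => sqDispersion k + δ k) (fderiv ℝ (fun k : Fin 2 → ℝ => sqDispersion k + δ k) x) x :=
  (((contDiff_sqDispersion (m := 2)).add hδs).differentiable (by norm_num) x).hasFDerivAt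

include hδs hκ in
/-- `‖DE‖ ≤ 4 + κ₁`. [folklore] -/
theorem norm_fderiv_bandPlus_le (x : Fin 2 → ℝ) : ‖fderiv ℝ (fun k : Fin 2 → ℝ => sqDispersion k + δ k) x‖ ≤ 4 + κ₁ := by
  have h1 : DifferentiableAt ℝ sqDispersion x := (contDiff_sqDispersion (m := 1)).differentiable (by norm_num) x
  have h2 : DifferentiableAt ℝ δ x := hδs.differentiable (by norm_num) x
  rw [fderiv_fun_add h1 h2]
  have hs : ‖fderiv ℝ sqDispersion x‖ ≤ 4 := by
    rw [← norm_iteratedFDeriv_zero (𝕜 := ℝ) (f := fderiv ℝ sqDispersion), norm_iteratedFDeriv_fderiv]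
    exact norm_iteratedFDeriv_sqDispersion_le 1 x
  exact (norm_add_le _ _).trans (add_le_add hs (hκ x))

include hδs hκ₂ in
/-- `DE` is `(4 + κ₂)`-Lipschitz. [folklore] -/
theorem norm_fderiv_bandPlus_sub_le (x y : Fin 2 → ℝ) :
    ‖fderiv ℝ (fun k : Fin 2 → ℝ => sqDispersion k + δ k) x - fderiv ℝ (fun k : Fin 2 → ℝ => sqDispersion k + δ k) y‖ ≤ (4 + κ₂) * ‖x - y‖ := by
  have hsd : Differentiable ℝ sqDispersion := (contDiff_sqDispersion (m := 1)).differentiable (by norm_num)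
  have hdd : Differentiable ℝ δ := hδs.differentiable (by norm_num)
  have hfe : fderiv ℝ (fun k : Fin 2 → ℝ => sqDispersion k + δ k) = fun k => fderiv ℝ sqDispersion k + fderiv ℝ δ k := by
    funext k; exact fderiv_fun_add (hsd k) (hdd k)
  rw [hfe]
  -- derivative of `k ↦ DE(k)` and its norm
  have hs2 : ∀ k, DifferentiableAt ℝ (fderiv ℝ sqDispersion) k := fun k =>
    ((contDiff_sqDispersion (m := 2)).fderiv_right (by norm_num) : ContDiff ℝ 1 (fderiv ℝ sqDispersion)).differentiable one_ne_zero k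
  have hd2 : ∀ k, DifferentiableAt ℝ (fderiv ℝ δ) k := fun k =>
    ((hδs.fderiv_right (by rw [one_add_one_eq_two])) : ContDiff ℝ 1 (fderiv ℝ δ)).differentiable one_ne_zero k
  have hbound : ∀ k : Fin 2 → ℝ, ‖fderiv ℝ (fun k => fderiv ℝ sqDispersion k + fderiv ℝ δ k) k‖ ≤ 4 + κ₂ := by
    intro k
    rw [fderiv_fun_add (hs2 k) (hd2 k)]
    have hs : ‖fderiv ℝ (fderiv ℝ sqDispersion) k‖ ≤ 4 := by
      rw [← norm_iteratedFDeriv_zero (𝕜 := ℝ) (f := fderiv ℝ (fderiv ℝ sqDispersion)), norm_iteratedFDeriv_fderiv, norm_iteratedFDeriv_fderiv]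
      exact norm_iteratedFDeriv_sqDispersion_le 2 k
    exact (norm_add_le (fderiv ℝ (fderiv ℝ sqDispersion) k) (fderiv ℝ (fderiv ℝ δ) k)).trans (add_le_add hs (hκ₂ k))
  exact (convex_univ (𝕜 := ℝ) (E := Fin 2 → ℝ)).norm_image_sub_le_of_norm_fderiv_le (fun k _ => (hs2 k).add (hd2 k)) (fun k _ => hbound k)
    (mem_univ y) (mem_univ x)

end BandPlus

/-! ## §2 The curve `γ = p_E` as a vector and the three thin tolerances -/

section ThinTolerance

variable {a b : ℝ} (B : BandBounds a b) {δ : (Fin 2 → ℝ) → ℝ} (hδs : ContDiff ℝ 2 δ) (heven : ∀ k, δ (-k) = δ k)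
  {κ₀ κ₁ κ₂ μ : ℝ} (hδ : ∀ k : Fin 2 → ℝ, |δ k| ≤ κ₀) (hlo : a ≤ μ - κ₀) (hhi : μ + κ₀ ≤ b)
  (hκ : ∀ k : Fin 2 → ℝ, ‖fderiv ℝ δ k‖ ≤ κ₁) (hκ₁ : κ₁ < B.Dtmin) (hκ₂ : ∀ k : Fin 2 → ℝ, ‖fderiv ℝ (fderiv ℝ δ) k‖ ≤ κ₂)
  {u : ℝ → ℝ} (hu : ∀ θ, IsBandFermiRadius (μ - δ (u θ • dir θ)) θ (u θ))

include B hδs hδ hlo hhi hκ hκ₁ hu in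
/-- The curve `θ ↦ (X_E θ, Y_E θ)` has derivative `(X_E′ θ, Y_E′ θ)`. [folklore] -/
theorem hasDerivAt_curveVec (θ : ℝ) :
    HasDerivAt (fun θ => (![XE u θ, YE u θ] : Fin 2 → ℝ)) (![VXE u θ, VYE u θ]) θ := by
  have hud : DifferentiableAt ℝ u θ := (differentiableAt_root_and_deriv B hδs hδ hlo hhi hκ hκ₁ hu θ).1
  refine hasDerivAt_pi.2 fun i => ?_
  fin_cases i
  · simpa using hasDerivAt_XE hud
  · simpa using hasDerivAt_YE hud

include B hδs hδ hlo hhi hκ hκ₁ hu in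
/-- `‖p_E′‖ ≤ S_E` (sup norm). [folklore] -/
theorem norm_curveVec_deriv_le (θ : ℝ) : ‖(![VXE u θ, VYE u θ] : Fin 2 → ℝ)‖ ≤ pcSE B κ₁ := by
  have h2ne : (2 : WithTop ℕ∞) ≠ 0 := by norm_num
  obtain ⟨hx, hy⟩ := abs_VXE_le B hδs h2ne (fun k _ => hδ k) hlo hhi (fun k _ => hκ k) hκ₁ hu θ
  exact norm_vec2_le ((abs_nonneg _).trans hx) hx hy

include B hδs hδ hlo hhi hκ hκ₁ hκ₂ hu in
/-- `p_E′` is `A_E`-Lipschitz (sup norm). [folklore] -/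
theorem norm_curveVec_deriv_sub_le (s t : ℝ) :
    ‖(![VXE u s, VYE u s] : Fin 2 → ℝ) - ![VXE u t, VYE u t]‖ ≤ pcAE B κ₁ κ₂ * |s - t| := by
  obtain ⟨hx, hy⟩ := abs_VXE_sub_VXE_le B hδs hδ hlo hhi hκ hκ₁ hκ₂ hu s t
  have h0 : 0 ≤ pcAE B κ₁ κ₂ * |s - t| := (abs_nonneg _).trans hx
  exact norm_vec2_sub_le h0 hx hy

include B hδs heven hδ hlo hhi hκ hκ₁ hu in
/-- Central symmetry of the curve vector: `p_E(θ + π) = −p_E(θ)` (even `δ`). [cite: BenfattoGiulianiMastropietro2006, §2.4 Lemma 2.1] -/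
theorem curveVec_add_pi (θ : ℝ) : (![XE u (θ + π), YE u (θ + π)] : Fin 2 → ℝ) = -![XE u θ, YE u θ] := by
  have h2ne : (2 : WithTop ℕ∞) ≠ 0 := by norm_num
  have hd' : ∀ k : Fin 2 → ℝ, (∀ i, |k i| ≤ π) → DifferentiableAt ℝ δ k := fun k _ => (hδs.differentiable h2ne) k
  obtain ⟨hx, hy, -, -⟩ := curve_add_pi B (fun k _ => hδ k) hlo hhi hd' (fun k _ => hκ k) hκ₁ hu heven θ
  ext i; fin_cases i <;> simp [hx, hy]

include hu in
/-- The root identity in vector form: `E(p_E(θ)) = μ`. [cite: BenfattoGiulianiMastropietro2006, §2.4 Lemma 2.1] -/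
theorem bandPlus_curveVec (θ : ℝ) : (fun k : Fin 2 → ℝ => sqDispersion k + δ k) ![XE u θ, YE u θ] = μ := by
  have hroot := ((isBandFermiRadius_shifted_iff δ μ θ (u θ)).1 (hu θ)).2
  rw [smul_dir_eq_XE_YE] at hroot
  exact hroot

omit B in
/-- `h^E_{p_E(θ₁)}(θ₂, θ₃) = E(p_E θ₁ + p_E θ₂ + p_E θ₃) − μ`. [folklore] -/
theorem hfunE_eq_bandPlus_curveVec (θ₁ θ₂ θ₃ : ℝ) :
    hfunE δ u μ (XE u θ₁, YE u θ₁) θ₂ θ₃ =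
      (fun k : Fin 2 → ℝ => sqDispersion k + δ k) (![XE u θ₁, YE u θ₁] + ![XE u θ₂, YE u θ₂] + ![XE u θ₃, YE u θ₃]) - μ := by
  have e : (![XE u θ₁, YE u θ₁] + ![XE u θ₂, YE u θ₂] + ![XE u θ₃, YE u θ₃] : Fin 2 → ℝ) = momE u (XE u θ₁, YE u θ₁) θ₂ θ₃ := by
    ext i; fin_cases i <;> simp [momE, SXE, SYE]
  rw [e, hfunE_eq_sqDispersion]

include B hδs heven hδ hlo hhi hκ hκ₁ hκ₂ hu

/-- **Thin COOPER tolerance on the perturbed curve.**  If `(θ₁′, x′, y′)` is a near-solution (`|h^E_{p_E(θ₁′)}(x′, y′)| ≤ ρ ≤ C_r w²`) within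
`ω ≤ w` of `(θ₁, x, x + c)` with defect `|y′ − x′ − π| ≥ d₀w > 0`, then
`|h^E_{p_E(θ₁)}(x, x + c)| ≤ (C_r + 2C_r/d₀ + 2(5HV² + 3GA) + (8HV² + 2GA))·w² + (5HV² + 3GA)·w·|c − π|` with `G = 4 + κ₁`, `H = 4 + κ₂`, `V = S_E`,
`A = A_E`. [cite: BenfattoGiulianiMastropietro2006, Lemma 3.1 / App. A2–A3] -/
theorem abs_hfunE_le_thin_cooper {θ₁ x c θ₁' x' y' ρ ω w Cr d₀ : ℝ} (hρ : |hfunE δ u μ (XE u θ₁', YE u θ₁') x' y'| ≤ ρ)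
    (hw : 0 < w) (hωw : ω ≤ w) (hCr : ρ ≤ Cr * w ^ 2) (hd₀ : 0 < d₀) (hd₀w : d₀ * w ≤ |y' - x' - π|)
    (h1 : |θ₁ - θ₁'| ≤ ω) (h2 : |x - x'| ≤ ω) (h3 : |x + c - y'| ≤ ω) :
    |hfunE δ u μ (XE u θ₁, YE u θ₁) x (x + c)| ≤
      (Cr + 2 * Cr / d₀ + 2 * (5 * ((4 + κ₂) * pcSE B κ₁ ^ 2) + 3 * ((4 + κ₁) * pcAE B κ₁ κ₂)) +
          (8 * ((4 + κ₂) * pcSE B κ₁ ^ 2) + 2 * ((4 + κ₁) * pcAE B κ₁ κ₂))) * w ^ 2 +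
        (5 * ((4 + κ₂) * pcSE B κ₁ ^ 2) + 3 * ((4 + κ₁) * pcAE B κ₁ κ₂)) * w * |c - π| := by
  have hκ₂0 : 0 ≤ κ₂ := (norm_nonneg (fderiv ℝ (fderiv ℝ δ) 0)).trans (hκ₂ 0)
  have hρ' : |(fun k : Fin 2 → ℝ => sqDispersion k + δ k) (![XE u θ₁', YE u θ₁'] + ![XE u x', YE u x'] + ![XE u y', YE u y']) - μ| ≤ ρ := by
    rw [← hfunE_eq_bandPlus_curveVec]; exact hρ
  have h := abs_level3_le_thin (F := Fin 2 → ℝ) (E := fun k : Fin 2 → ℝ => sqDispersion k + δ k) (hasFDerivAt_bandPlus hδs)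
    (norm_fderiv_bandPlus_le hδs hκ) (norm_fderiv_bandPlus_sub_le hδs hκ₂) (by linarith)
    (γ := fun θ => (![XE u θ, YE u θ] : Fin 2 → ℝ)) (γ' := fun θ => (![VXE u θ, VYE u θ] : Fin 2 → ℝ))
    (hasDerivAt_curveVec B hδs hδ hlo hhi hκ hκ₁ hu) (norm_curveVec_deriv_le B hδs hδ hlo hhi hκ hκ₁ hu)
    (norm_curveVec_deriv_sub_le B hδs hδ hlo hhi hκ hκ₁ hκ₂ hu) (curveVec_add_pi B hδs heven hδ hlo hhi hκ hκ₁ hu)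
    (bandPlus_curveVec hu) hρ' hw hωw hCr hd₀ hd₀w h1 h2 h3
  rw [← hfunE_eq_bandPlus_curveVec] at h
  exact h

/-- **Thin FOLD tolerance on the perturbed curve.**  A near-solution `(θ₁′, a′, c′)` within `ω ≤ w` of `(θ₁, σ − t/2, σ + t/2)` (`t ≥ 0`) gives
`|h^E_{p_E(θ₁)}(σ − t/2, σ + t/2)| ≤ (C_r + 8K₃)·w² + 2K₃·w·|σ − θ₁ − π| + K₃·w·t`, `K₃ = 3HV² + 2GA`.
[cite: BenfattoGiulianiMastropietro2006, Lemma 3.1 / App. A2–A3] -/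
theorem abs_hfunE_le_thin_fold {θ₁ σ t θ₁' a' c' ρ ω w Cr : ℝ} (hρ : |hfunE δ u μ (XE u θ₁', YE u θ₁') a' c'| ≤ ρ)
    (hw : 0 < w) (hωw : ω ≤ w) (hCr : ρ ≤ Cr * w ^ 2) (ht : 0 ≤ t)
    (h1 : |θ₁ - θ₁'| ≤ ω) (h2 : |σ - t / 2 - a'| ≤ ω) (h3 : |σ + t / 2 - c'| ≤ ω) :
    |hfunE δ u μ (XE u θ₁, YE u θ₁) (σ - t / 2) (σ + t / 2)| ≤
      (Cr + 8 * (3 * ((4 + κ₂) * pcSE B κ₁ ^ 2) + 2 * ((4 + κ₁) * pcAE B κ₁ κ₂))) * w ^ 2 +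
        2 * (3 * ((4 + κ₂) * pcSE B κ₁ ^ 2) + 2 * ((4 + κ₁) * pcAE B κ₁ κ₂)) * w * |σ - θ₁ - π| +
        (3 * ((4 + κ₂) * pcSE B κ₁ ^ 2) + 2 * ((4 + κ₁) * pcAE B κ₁ κ₂)) * w * t := by
  have hκ₂0 : 0 ≤ κ₂ := (norm_nonneg (fderiv ℝ (fderiv ℝ δ) 0)).trans (hκ₂ 0)
  have hρ' : |(fun k : Fin 2 → ℝ => sqDispersion k + δ k) (![XE u θ₁', YE u θ₁'] + ![XE u a', YE u a'] + ![XE u c', YE u c']) - μ| ≤ ρ := by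
    rw [← hfunE_eq_bandPlus_curveVec]; exact hρ
  have h := abs_level3_le_thin_fold (F := Fin 2 → ℝ) (E := fun k : Fin 2 → ℝ => sqDispersion k + δ k) (hasFDerivAt_bandPlus hδs)
    (norm_fderiv_bandPlus_le hδs hκ) (norm_fderiv_bandPlus_sub_le hδs hκ₂) (by linarith)
    (γ := fun θ => (![XE u θ, YE u θ] : Fin 2 → ℝ)) (γ' := fun θ => (![VXE u θ, VYE u θ] : Fin 2 → ℝ))
    (hasDerivAt_curveVec B hδs hδ hlo hhi hκ hκ₁ hu) (norm_curveVec_deriv_le B hδs hδ hlo hhi hκ hκ₁ hu)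
    (norm_curveVec_deriv_sub_le B hδs hδ hlo hhi hκ hκ₁ hκ₂ hu) (curveVec_add_pi B hδs heven hδ hlo hhi hκ hκ₁ hu)
    (bandPlus_curveVec hu) hρ' hw hωw hCr ht h1 h2 h3
  rw [← hfunE_eq_bandPlus_curveVec] at h
  exact h

omit hκ₂ heven in
/-- **Fat tolerance on the perturbed curve.**  A near-solution within `ω` of `(θ₁, a, c)` gives `|h^E_{p_E(θ₁)}(a, c)| ≤ ρ + 3(4 + κ₁)S_E·ω`.
[cite: BenfattoGiulianiMastropietro2006, Lemma 3.1 / App. A2–A3] -/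
theorem abs_hfunE_le_fat {θ₁ a₀ c₀ θ₁' a' c' ρ ω : ℝ} (hρ : |hfunE δ u μ (XE u θ₁', YE u θ₁') a' c'| ≤ ρ)
    (h1 : |θ₁ - θ₁'| ≤ ω) (h2 : |a₀ - a'| ≤ ω) (h3 : |c₀ - c'| ≤ ω) :
    |hfunE δ u μ (XE u θ₁, YE u θ₁) a₀ c₀| ≤ ρ + 3 * ((4 + κ₁) * pcSE B κ₁) * ω := by
  have hρ' : |(fun k : Fin 2 → ℝ => sqDispersion k + δ k) (![XE u θ₁', YE u θ₁'] + ![XE u a', YE u a'] + ![XE u c', YE u c']) - μ| ≤ ρ := by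
    rw [← hfunE_eq_bandPlus_curveVec]; exact hρ
  have h := abs_level3_le_of_near_zero_fat (F := Fin 2 → ℝ) (E := fun k : Fin 2 → ℝ => sqDispersion k + δ k) (hasFDerivAt_bandPlus hδs)
    (norm_fderiv_bandPlus_le hδs hκ)
    (γ := fun θ => (![XE u θ, YE u θ] : Fin 2 → ℝ)) (γ' := fun θ => (![VXE u θ, VYE u θ] : Fin 2 → ℝ))
    (hasDerivAt_curveVec B hδs hδ hlo hhi hκ hκ₁ hu) (norm_curveVec_deriv_le B hδs hδ hlo hhi hκ hκ₁ hu)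
    hρ' h1 h2 h3
  rw [← hfunE_eq_bandPlus_curveVec] at h
  exact h

end ThinTolerance

end Summit.HubbardSuperconductivity.HubbardSuperconductivity.Theorems.PerturbedFermiCurve

end
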